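import Summits.SmoothPoincare4.SmoothPoincare4.Theses.ChargedHalfTurns
import Summits.SmoothPoincare4.SmoothPoincare4.Theses.QuotientSpheres
import HarnessLib
import HarnessLib.Audit

/-!
# Birth skeleton (BC3) — crux `ChargedHalfTurns.InvolutionPSC` (item stmt-SmoothPoincare4-18211)

Route `route-SmoothPoincare4-ChargedHalfTurns` (NEGATIVE-SIDE route; deciding theorem
`closes : ChargedSphere → InvolutionPSC → ¬ SmoothPoincare4`), crux #2 `InvolutionPSC` — the OBSTRUCTION half, the
route's bet, "equivariant PSC rigidity of the standard 4-sphere": for every smooth 4-manifold `M` diffeomorphic to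
`S⁴` (any carrier and atlas) and every HALF-TURN of `M` — a smooth involution `ι` whose fixed-point set is the image
of a smooth embedding `e : S² → M` — there is a `C^∞` Riemannian metric `g` on `M` with Levi-Civita connection,
`scal_g > 0` everywhere and `ι^* g = g` (`pullbackBilin`). Verbatim the route decl
`Summit.SmoothPoincare4.SmoothPoincare4.Theses.ChargedHalfTurns.InvolutionPSC`; never restated or weakened here.

## The line `birth` — the QUOTIENT ∕ DECK split (the route header's declared two-layer plan
"InvolutionPSC ⇐ QuotientStandard → DeckPSC"), its middle node SHARED with route `QuotientSpheres`

Dictionary. A half-turn `(M, ι)` is the deck transformation of the 2-fold cover `π : M → X := M/ι` branched along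
the 2-sphere `S := π (Fix ι) ⊂ X`; the orbit space `X` carries a canonical smooth structure (Hambleton–Hausmann fold
charts `(z, w) ↦ (z, w²)` along `Fix ι`, HambletonHausmann2010 App. §7, Def. 7.1 / Lemma 7.3) in which `S` is a
smoothly embedded 2-sphere, `X` is a smooth homotopy 4-sphere (Armstrong: `π₁(M/ι) = π₁(M)/⟨elements with fixed
points⟩ = 1`; transfer: `b₂(X) = b₂(M)^ι = 0`; Freedman), and `ι`-invariant Riemannian metrics on `M` are the same
thing as Riemannian ORBIFOLD metrics on `(X, S)` with cone angle `π` along `S`. So `InvolutionPSC` reads: every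
2-knot `S` in a homotopy 4-sphere `X` whose 2-fold cyclic branched cover is `S⁴` carries a PSC orbifold metric of
angle `π`. The line cuts this statement at the quotient, in three named pieces:

* STUB 1 `stub_halfTurnQuotient` — THE ORBIT SPACE EXISTS (known in substance, never formalised; Lean size L–XL):
  for every half-turn `(ι, e)` of ANY smooth 4-manifold `M` (Hausdorff, second countable, `C^∞` atlas on `ℝ⁴`) there
  is a smooth 4-manifold `X` with an ORDER-2 CYCLIC BRANCHED QUOTIENT DATUM `(ι, X, π)` in the exact shape inlined in
  the items of route `QuotientSpheres` (`π : M → X` smooth and surjective, fibres the `ι`-orbits, a local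
  diffeomorphism off `Fix ι`, fold charts `ψ ∘ π = ((z, w) ↦ (z, w²)) ∘ φ` at the points of `Fix ι`), and moreover
  `π ∘ e : S² → X` is a smooth embedding (the BRANCH 2-KNOT). In print: linearise `ι` along `Fix ι` by an invariant
  metric / equivariant tubular neighbourhood (Bredon1972 VI.2; `Fix ι = e(S²)` forces the `(−1)`-eigenbundle of `dι`
  to have rank 2 at every fixed point), give `(M ∖ Fix ι)/ι` its free-quotient atlas and glue in the squaring charts
  (HambletonHausmann2010 Lemma 7.3). NOT the crux: it produces no metric and decides nothing about `X`
  (probes below). Why it might fail: only through a typing slip in the datum — which is the refuter-reviewed datum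
  of route `QuotientSpheres` (route review 2026-08-15: the chart clause forces `ι` of exact order 2 near `Fix`, `Fix`
  2-dimensional, `ι` free off `Fix`; junk models excluded) with `g := ι`, `q := π`.
* STUB 2 `stub_quotientStandard` := `QuotientSpheres.InvolutionQuotient` BY NAME — item stmt-SmoothPoincare4-8188,
  crux #2 of route `route-SmoothPoincare4-QuotientSpheres`, OPEN, with its own registered skeleton
  `Cruxes/InvolutionQuotient/Lines/birth.lean` (Gluck normal form ∧ Gluck twists along branch knots are standard):
  every order-2 cyclic branched quotient of the STANDARD `S⁴` is diffeomorphic to `S⁴`. A consequence of SPC4 (the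
  quotient is a homotopy sphere); true for every half-turn of `S⁴` known (linear ones; the Giffen–Gordon–Pao deck
  involutions over odd twist-spun knots, whose quotient is `S⁴` by construction). Filed as a stub BY NAME so that
  closing item 8188 discharges it verbatim — a shared node, not a re-filing (the file audit classifies it
  `proof-of-item` of that route; it is `sorry`ed here like any stub). NOT the crux (different conclusion; probes
  fail). Why it might fail: an involution of `S⁴` with EXOTIC orbit space — then this LINE dies while `InvolutionPSC`
  may survive (the successor line would replace "X ≅ S⁴" by the weaker interface "X admits a PSC metric", at the price
  of STUB 3's transfer, see below).
* STUB 3 `stub_deckPSC` — DECK INVOLUTIONS OVER BRANCH 2-KNOTS OF `S⁴` PRESERVE PSC (OPEN; the load-bearing stub):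
  for every half-turn `(ι, e)` of `M ≅ S⁴` that is the deck transformation of an order-2 cyclic branched quotient datum
  `(ι, X, π)` with `X ≅ S⁴`, `ι` preserves some PSC metric (conclusion verbatim the crux's). Downstairs: every 2-knot
  `S ⊂ S⁴` whose 2-fold cyclic branched cover is again `S⁴` (a BRANCH KNOT) carries a Riemannian orbifold metric
  with cone angle `π` along `S` and positive scalar curvature. TRANSFER — why this is easier to attack than the crux as
  typed: the unknown 4-manifold-with-involution is replaced by a CLASSICAL object, a 2-knot in the standard `S⁴`
  (banded-unlink / motion-picture presentations; spins, twist-spins, rolls, satellites — Plotnick1984), and the metric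
  question becomes the ORBIFOLD YAMABE PROBLEM `Y(S⁴, S; angle π) > 0` on a fixed background (edge Yamabe theory:
  Akutagawa–Carron–Mazzeo arXiv:1210.8054; edge-cone curvature calculus in dimension 4: Atiyah–LeBrun arXiv:1203.6389,
  LeBrun arXiv:1305.1960 = doi:10.2969/jmsj/06730979), while the equivariant tools upstairs remain available on their
  sectors (Wiemeler arXiv:1305.2288 Thm 1.1 for branch knots fixed by a smooth circle action = route support
  `CircleRung`, stmt-18213; Hanke's equivariant Gromov–Lawson surgery arXiv:math/0512284 in codimension ≥ 3). Known
  sub-cases = the route's rungs: `S` unknotted ⟺ `ι` linear (round metric; planner BC5 evidence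
  `InvolutionPSC_special.lean` on the item); the GIFFEN RUNG (odd twist-spins, informal item stmt-18257) is its first
  open sector. Why it might fail — exactly the route's kill switch, inherited unchanged: the roll-spun pretzel 2-knot
  `S = ρP(−2,3,7) ⊂ S⁴` has real Seiberg–Witten degree `3` (Miyazawa arXiv:2312.02041 Thm 4.32), so `(S⁴, S)` has NO
  angle-`π` PSC orbifold metric (Prop. 3.14; Baraglia arXiv:2504.00281 Prop. 1.3(3)); STUB 3 survives iff the 2-fold
  branched cover `Σ₂(S⁴, ρP(−2,3,7))` (a homotopy sphere, Thm 4.44; a Gluck twist of `S⁴`, Kuhrman arXiv:2507.03798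
  Cor. 2.9; HKM arXiv:2402.11706 Q. 1.4) is EXOTIC (informal kill item stmt-18258 `KuhrmanSphereStandard`). Hence any
  proof must USE `M ≅ S⁴`, the standardness of the COVER, which no local metric-bending argument sees: lowering the
  cone angle from `2π` to `π` COSTS scalar curvature (the transverse profile must turn convex), so "X admits PSC ⇒
  (X, S) admits an angle-π PSC orbifold metric" is false in general (it fails for `ρP(−2,3,7)` in the round `S⁴`) —
  which is why the interface between STUB 2 and STUB 3 is `X ≅ S⁴` (2-knot theory), not merely "X admits PSC".

COMPOSITION (kernel-checked, no `sorry` outside the three stubs): `involutionPSC_of_stubs : ⟨stub₁-sig⟩ →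
InvolutionQuotient → ⟨stub₃-sig⟩ → ⟨the crux statement, spelled as in the route file⟩` — take the half-turn
`(ι, e)` of `M` and `Φ : M ≅ S⁴`; STUB 1 gives `(X, π)`; TRANSPORT along `Φ` (`g := Φ ∘ ι ∘ Φ⁻¹`, `q := π ∘ Φ⁻¹`,
fold charts `φ ∘ Φ⁻¹` on `Φ(U)`; a fixed point `Φ (e p₀)`; `Function.Semiconj.iterate_right` for the orbit clause;
`IsLocalDiffeomorphAt.comp` with `Diffeomorph.isLocalDiffeomorph` for the local-diffeomorphism clauses) makes
`(g, X, q)` an order-2 cyclic branched quotient datum of the LITERAL `S⁴` with the same orbit space `X`, so STUB 2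
gives `X ≅ S⁴`; STUB 3 concludes. THE skeleton theorem is `InvolutionPSC_of : ChargedHalfTurns.InvolutionPSC :=
involutionPSC_of_stubs stub_halfTurnQuotient stub_quotientStandard stub_deckPSC` — the crux BY NAME, deliberately the
only theorem of the file whose conclusion is the crux constant (the arrow form with the crux by name is the closing
`example`, as in the registered skeletons `Cruxes/InvolutionQuotient/Lines/birth.lean`,
`Cruxes/CyclicQuotient/Lines/birth.lean`). `lean check`: rc 0, 3 sorries = 3 stubs, zero elsewhere
(`involutionPSC_of_stubs` closed).

In substance the line is a FACTORISATION modulo STUB 2: `InvolutionPSC ⟹ STUB 3` trivially (drop the extra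
hypotheses) and STUB 1 is a theorem, so GIVEN `InvolutionQuotient` the crux is EQUIVALENT to STUB 3; the split adds no
falsity risk to the crux except through STUB 2, an independently staffed crux of another route. What it buys: the
formalisation debt (STUB 1) is isolated and provable now; the recognition question (STUB 2) is shared; the geometric
heart (STUB 3) is re-typed over a classical object with a named toolbox and inherits the kill switch verbatim.

HARDEST STUB: `stub_deckPSC` (open problem — conjecturally the whole crux, since STUB 2 says the standard-quotient
sector is everything). STUB 2 is open but staffed on route `QuotientSpheres`; STUB 1 is L–XL Lean work, no open
mathematics.

## Disproof used / negatives

`ledger crux ls stmt-SmoothPoincare4-18211` (2026-08-17): no workfiles — no `Disproof.lean`, no dead line, no landed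
`Negative/` lemma for this crux; `ledger negatives --problem SmoothPoincare4`: 0 refuted statements. Item evidence
honoured: refuter crux-attack at birth (`CRUX-ATTACK.md`, 2026-08-17): `M ≅ S⁴` and `Fix ι = e(S²)` are load-bearing
— both kept verbatim in STUBS 1 and 3; "strengthening to linearisability is FALSE (Giffen/Gordon/Pao knotted fixed
spheres)" — no stub asserts linearisability (STUB 3 allows knotted branch loci, STUB 1 any half-turn); the sharpened
falsifier (torus-knot roll-spins `Σ₂(ρT(p,q)) ≅ S⁴`, `|deg| = 1`) is consistent with STUB 3; "not a proving target in
general position" — agreed: the provable-now content is STUB 1 and the rungs of STUB 3.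

## Barriers (route header `Literature.Barriers.SmoothPoincare4.*`, placed per stub)

* `GaugeSumBarrierFour`: not engaged by STUBS 1–2 (no invariant of a homotopy sphere alone is used); in STUB 3 the real
  Seiberg–Witten degree of the PAIR `(Σ, ι)` enters only as the kill switch (it is defined at `b₂⁺ = 0` and not
  sum-stable — outside the barrier's class), never as a tool of the line.
* `CircleActionBarrierFour`: consistent — branch knots preserved by an effective smooth circle action (twist-spins,
  Pao1978) form the sector of STUB 3 covered by `CircleRung` / Wiemeler; the barrier (charged covers extend to no
  circle action) constrains the SUPPLY crux `ChargedSphere`, not STUB 3 on standard covers.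
* `ProjectiveRigidityBarrierFour`: void — `Fix ι = e(S²) ≠ ∅` in every stub (no free involutions, no fake `ℝP⁴`).
* `GluckTwistCP2Barrier`: bears on STUB 2 through its own skeleton (Gluck twists along branch knots) and on STUB 3's
  kill switch (`Σ₂(S⁴, ρP(−2,3,7))` is a Gluck twist of `S⁴`, invisible to `ℂP²`-stable invariants: the kill cannot be
  RUN by stable gauge theory, in either direction); it does not obstruct a positive proof of STUB 3.

## BC3 probes (registrar, 2026-08-17; files `bc/probe_*.lean`, `bc/fine_*.lean`, `bc/aesop_big.lean` in the
registrar's folder; rc and goals quoted in its NOTES.md and in the evidence note on the item)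

For each stub `X ∈ {stub_halfTurnQuotient, stub_quotientStandard (= InvolutionQuotient), stub_deckPSC}` and each
target `T ∈ {InvolutionPSC, SmoothPoincare4, ¬ SmoothPoincare4}` (the route is a refutation route, so both signs of
the summit statement are probed): `set_option maxHeartbeats 400000 in example : ⟨X-sig⟩ → T := by
first | exact? | simpa [X?, T] | aesop` — all 9 FAIL (rc 1, heartbeat exhaustion inside the battery). One tactic at a
time: `exact?` — "could not close the goal" 9/9; `simpa` — whnf timeout 9/9; `aesop` — "failed to prove the goal
after exhaustive search" for STUB 2 (3/3 at 400 000) and for STUB 1 → InvolutionPSC, → ¬SmoothPoincare4 (at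
3 000 000), "error in norm simp: maximum number of steps exceeded" for STUB 3 → InvolutionPSC, → ¬SmoothPoincare4 (at
3 000 000), timeout otherwise. No stub is cheaply the crux or the summit (no shredding, no costume by probe); the
informal costume check is the factorisation paragraph above (STUB 3 is weaker than the crux by the OPEN hypothesis
`X ≅ S⁴`, which is what makes the 2-knot transfer available).

## References

* I. Hambleton, J.-C. Hausmann, *Conjugation spaces and 4-manifolds*, Math. Z. 269 (2011), arXiv:0906.5057 — App. §7,
  Def. 7.1, Lemma 7.3 (quotient smooth structure, branched charts); Prop. 5.3. [HambletonHausmann2010]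
* G. Bredon, *Introduction to compact transformation groups*, Academic Press (1972), Ch. VI §2 (equivariant tubular
  neighbourhoods, linearisation at fixed sets). [Bredon1972]
* J. Miyazawa, *A gauge theoretic invariant of embedded surfaces in 4-manifolds and exotic P²-knots*,
  arXiv:2312.02041 — Def. 3.4, Prop. 3.14, Thm 4.32, Thm 4.44, Thm 4.46 (p. 42). [arXiv:2312.02041]
* D. Baraglia, arXiv:2504.00281 — Prop. 1.3(3) / 6.1(3) (PSC-invariant Real spin involutions have `|deg| = 1`).
* T. Kuhrman, arXiv:2507.03798 — Lemma 2.6, Cor. 2.9, Prop. 3.5, §5 Q1/Q3. M. Hughes, S. Kim, M. Miller,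
  arXiv:2402.11706 — Thm 1.1, Rem. 1.3(2), Q. 1.4.
* M. Wiemeler, *Circle actions and scalar curvature*, Trans. AMS 368 (2016), arXiv:1305.2288 — Thm 1.1. B. Hanke,
  *Positive scalar curvature with symmetry*, J. reine angew. Math. 614 (2008), arXiv:math/0512284.
* K. Akutagawa, G. Carron, R. Mazzeo, *The Yamabe problem on stratified spaces*, GAFA 24 (2014), arXiv:1210.8054.
  M. Atiyah, C. LeBrun, *Curvature, cones and characteristic numbers*, Math. Proc. Camb. Phil. Soc. 155 (2013),
  arXiv:1203.6389. C. LeBrun, *Edges, orbifolds, and Seiberg–Witten theory*, J. Math. Soc. Japan 67 (2015),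
  doi:10.2969/jmsj/06730979.
* C. H. Giffen, Amer. J. Math. 88 (1966); C. McA. Gordon, Proc. LMS 29 (1974); P. S. Pao, Topology 17 (1978);
  S. P. Plotnick, *Fibered knots in S⁴ — twisting, spinning, rolling, surgery, and branching*, Contemp. Math. 35 (1984).
  [Giffen1966] [Gordon1974] [Pao1978] [Plotnick1984]
-/


-- `Summit.<Summit>.<Problem>`: single-conjunct summit, the duplicate component is mandated (CONVENTIONS §2).
set_option linter.dupNamespace false
set_option linter.unusedVariables false

noncomputable section

namespace Summit.SmoothPoincare4.SmoothPoincare4.Cruxes.InvolutionPSC.Birth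

open scoped Manifold ContDiff Topology

/-! ## The three registered stubs (`sorry` lives ONLY here; signatures spelled out over tree declarations)

Inline vocabulary: `S⁴ := Metric.sphere (0 : EuclideanSpace ℝ (Fin 5)) 1`, `S² := Metric.sphere (0 : EuclideanSpace ℝ (Fin 3)) 1` (Mathlib manifold structures,
models `𝓡 4`, `𝓡 2`); a HALF-TURN of `M` = the crux hypotheses verbatim (`ι` smooth, `ι ∘ ι = id`, `e : S² → M` a smooth
embedding, `Fix ι = range e`); the ORDER-2 QUOTIENT DATUM `(ι, X, π)` = the hypothesis block of
`QuotientSpheres.InvolutionQuotient` verbatim with `g := ι` (on `M`) and `q := π : M → X` (smooth surjection, fibres the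
`ι`-orbits, local diffeomorphism off `Fix ι`, Hambleton–Hausmann fold charts `ψ ∘ π = ((z, w) ↦ (z, w²)) ∘ φ` at `Fix ι`). -/

/-- **STUB 1 `stub_halfTurnQuotient` — THE ORBIT SPACE OF A HALF-TURN (registered; known in substance, Lean L–XL).**
For every half-turn `(ι, e)` of a smooth 4-manifold `M` (the crux hypotheses on `ι`, `e` verbatim, NO hypothesis on the
diffeomorphism type of `M`) there are a smooth 4-manifold `X` (Hausdorff, second countable, `C^∞` atlas on `ℝ⁴`) and a
map `π : M → X` forming an ORDER-2 CYCLIC BRANCHED QUOTIENT DATUM — the hypothesis block of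
`QuotientSpheres.InvolutionQuotient` verbatim with `g := ι`, `q := π` (`π` smooth, surjective, fibres the `ι`-orbits,
a local diffeomorphism off `Fix ι`, Hambleton–Hausmann fold charts `ψ ∘ π = ((z, w) ↦ (z, w²)) ∘ φ` at `Fix ι`) — with
`π ∘ e : S² → X` a smooth embedding (the branch 2-knot). The canonical smooth structure on `M/ι`
(HambletonHausmann2010 App. §7 Def. 7.1 / Lemma 7.3; linearisation along `Fix ι`: Bredon1972 VI.2). Not the crux: no
metric, no recognition. Size: L–XL (an atlas construction), no open mathematics.
[cite: HambletonHausmann2010, Appendix §7, Definition 7.1 / Lemma 7.3 (quotient smooth structure, branched charts)] -/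
theorem stub_halfTurnQuotient :
    ∀ (M : Type) [TopologicalSpace M] [T2Space M] [SecondCountableTopology M]
      [ChartedSpace (EuclideanSpace ℝ (Fin 4)) M] [IsManifold (𝓡 4) ∞ M]
      (ι : M → M) (e : Metric.sphere (0 : EuclideanSpace ℝ (Fin 3)) 1 → M),
      ContMDiff (𝓡 4) (𝓡 4) ∞ ι → ι ∘ ι = id →
      Manifold.IsSmoothEmbedding (𝓡 2) (𝓡 4) ∞ e → (∀ x, ι x = x ↔ x ∈ Set.range e) →
      ∃ (X : Type) (_ : TopologicalSpace X) (_ : T2Space X) (_ : SecondCountableTopology X)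
        (_ : ChartedSpace (EuclideanSpace ℝ (Fin 4)) X) (_ : IsManifold (𝓡 4) ∞ X) (π : M → X),
        (ContMDiff (𝓡 4) (𝓡 4) ∞ ι ∧ ι^[2] = id ∧ ContMDiff (𝓡 4) (𝓡 4) ∞ π ∧ (∀ x, π (ι x) = π x) ∧
          (∀ x y, π x = π y → ∃ k : ℕ, y = ι^[k] x) ∧ Function.Surjective π ∧
          (∀ x, ι x ≠ x → IsLocalDiffeomorphAt (𝓡 4) (𝓡 4) ∞ π x) ∧
          ∀ x, ι x = x → ∃ (U : Set M) (φ : M → EuclideanSpace ℝ (Fin 4)) (V : Set X) (ψ : X → EuclideanSpace ℝ (Fin 4)),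
            IsOpen U ∧ x ∈ U ∧ Set.InjOn φ U ∧ (∀ y ∈ U, IsLocalDiffeomorphAt (𝓡 4) (𝓡 4) ∞ φ y) ∧ IsOpen V ∧
            π '' U ⊆ V ∧ Set.InjOn ψ V ∧ (∀ z ∈ V, IsLocalDiffeomorphAt (𝓡 4) (𝓡 4) ∞ ψ z) ∧
            ∀ y ∈ U, ψ (π y) = WithLp.toLp 2 (fun j : Fin 4 =>
              if j = 2 then ((((φ y 2 : ℝ) : ℂ) + ((φ y 3 : ℝ) : ℂ) * Complex.I) ^ 2).re
              else if j = 3 then ((((φ y 2 : ℝ) : ℂ) + ((φ y 3 : ℝ) : ℂ) * Complex.I) ^ 2).im else φ y j)) ∧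
        Manifold.IsSmoothEmbedding (𝓡 2) (𝓡 4) ∞ (π ∘ e) := by
  sorry

/-- **STUB 2 `stub_quotientStandard` — ORDER-2 QUOTIENTS OF THE STANDARD `S⁴` ARE STANDARD (registered; OPEN; SHARED).**
Literally the crux `QuotientSpheres.InvolutionQuotient` of route `route-SmoothPoincare4-QuotientSpheres` (item
stmt-SmoothPoincare4-8188), BY NAME: for every smooth involution `g` of the literal `S⁴` with a fixed point and every
order-2 cyclic branched quotient datum `(g, M, q)`, `M ≅ S⁴`. A consequence of SPC4; true for all known half-turns of
`S⁴`; it has its own registered skeleton (`Cruxes/InvolutionQuotient/Lines/birth.lean`). Closing item 8188 discharges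
this stub verbatim. Not the crux `InvolutionPSC` (no metric is produced). Size: open problem (staffed elsewhere).
[cite: HambletonHausmann2010, Prop. 5.3 (involutions on homotopy 4-spheres with fixed 2-sphere, up to homeomorphism)] -/
theorem stub_quotientStandard :
    Summit.SmoothPoincare4.SmoothPoincare4.Theses.QuotientSpheres.InvolutionQuotient := by
  sorry

/-- **STUB 3 `stub_deckPSC` — DECK INVOLUTIONS OVER BRANCH 2-KNOTS OF `S⁴` PRESERVE PSC (registered; OPEN; load-bearing).**
For every half-turn `(ι, e)` of a smooth 4-manifold `M ≅ S⁴` (crux hypotheses verbatim) which is the deck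
transformation of an order-2 cyclic branched quotient datum `(ι, X, π)` (STUB 1's output, verbatim) whose orbit space
is STANDARD, `X ≅ S⁴`, the involution `ι` preserves some `C^∞` Riemannian metric of positive scalar curvature (the
crux conclusion verbatim). Downstairs: every 2-knot `S ⊂ S⁴` whose 2-fold cyclic branched cover is `S⁴` carries a
PSC orbifold metric with cone angle `π` along `S` (orbifold Yamabe problem on `(S⁴, S; π)`; edge-cone calculus
arXiv:1210.8054, arXiv:1203.6389). Implied by the crux (drop the extra hypotheses); known for `S` unknotted (linear
`ι`, round metric — the item's BC5 evidence) and, via Wiemeler's Thm 1.1 (route support `CircleRung`), aimed at the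
twist-spin sector (Giffen rung, item stmt-18257). Why it might fail: `(S⁴, ρP(−2,3,7))` has real Seiberg–Witten degree 3,
hence no angle-`π` PSC orbifold metric (arXiv:2312.02041 Thm 4.32 + Prop. 3.14; arXiv:2504.00281 Prop. 1.3(3)) — the stub
survives iff `Σ₂(S⁴, ρP(−2,3,7))` is exotic (kill item stmt-18258); any proof must use `M ≅ S⁴`. Size: open problem.
[cite: arXiv:2312.02041, Prop. 3.14 and Thm 4.46 (PSC-invariant half-turns have |deg| = 1; the dichotomy)] -/
theorem stub_deckPSC :
    ∀ (M : Type) [TopologicalSpace M] [T2Space M] [SecondCountableTopology M]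
      [ChartedSpace (EuclideanSpace ℝ (Fin 4)) M] [IsManifold (𝓡 4) ∞ M],
      Nonempty (M ≃ₘ⟮𝓡 4, 𝓡 4⟯ Metric.sphere (0 : EuclideanSpace ℝ (Fin 5)) 1) →
      ∀ (ι : M → M) (e : Metric.sphere (0 : EuclideanSpace ℝ (Fin 3)) 1 → M),
      ContMDiff (𝓡 4) (𝓡 4) ∞ ι → ι ∘ ι = id →
      Manifold.IsSmoothEmbedding (𝓡 2) (𝓡 4) ∞ e → (∀ x, ι x = x ↔ x ∈ Set.range e) →
      ∀ (X : Type) [TopologicalSpace X] [T2Space X] [SecondCountableTopology X]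
        [ChartedSpace (EuclideanSpace ℝ (Fin 4)) X] [IsManifold (𝓡 4) ∞ X] (π : M → X),
        (ContMDiff (𝓡 4) (𝓡 4) ∞ ι ∧ ι^[2] = id ∧ ContMDiff (𝓡 4) (𝓡 4) ∞ π ∧ (∀ x, π (ι x) = π x) ∧
          (∀ x y, π x = π y → ∃ k : ℕ, y = ι^[k] x) ∧ Function.Surjective π ∧
          (∀ x, ι x ≠ x → IsLocalDiffeomorphAt (𝓡 4) (𝓡 4) ∞ π x) ∧
          ∀ x, ι x = x → ∃ (U : Set M) (φ : M → EuclideanSpace ℝ (Fin 4)) (V : Set X) (ψ : X → EuclideanSpace ℝ (Fin 4)),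
            IsOpen U ∧ x ∈ U ∧ Set.InjOn φ U ∧ (∀ y ∈ U, IsLocalDiffeomorphAt (𝓡 4) (𝓡 4) ∞ φ y) ∧ IsOpen V ∧
            π '' U ⊆ V ∧ Set.InjOn ψ V ∧ (∀ z ∈ V, IsLocalDiffeomorphAt (𝓡 4) (𝓡 4) ∞ ψ z) ∧
            ∀ y ∈ U, ψ (π y) = WithLp.toLp 2 (fun j : Fin 4 =>
              if j = 2 then ((((φ y 2 : ℝ) : ℂ) + ((φ y 3 : ℝ) : ℂ) * Complex.I) ^ 2).re
              else if j = 3 then ((((φ y 2 : ℝ) : ℂ) + ((φ y 3 : ℝ) : ℂ) * Complex.I) ^ 2).im else φ y j)) →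
        Manifold.IsSmoothEmbedding (𝓡 2) (𝓡 4) ∞ (π ∘ e) →
        Nonempty (X ≃ₘ⟮𝓡 4, 𝓡 4⟯ Metric.sphere (0 : EuclideanSpace ℝ (Fin 5)) 1) →
        ∃ (g : Literature.Geometry.Lorentzian.PseudoRiemannianMetric (𝓡 4) ∞ (EuclideanSpace ℝ (Fin 4)) (TangentSpace (𝓡 4) : M → Type _)) (_ : g.HasLeviCivita),
          g.IsRiemannian ∧ (∀ x, 0 < g.scalarCurvature x) ∧
          ∀ y, Literature.Geometry.Lorentzian.pullbackBilin (I := 𝓡 4) (I' := 𝓡 4) ι g.val y = g.val y := by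
  sorry

/-! ## Composition: stubs ⟹ crux (no `sorry` below this line) -/

/-- **The quotient/deck split of `InvolutionPSC`, arrow form** (conclusion = the crux statement, spelled as in the
route file; this arrow theorem is not a by-name candidate for the skeleton audit — the by-name theorem is
`InvolutionPSC_of` below). Given a half-turn `(ι, e)` of `M ≅ S⁴`: STUB 1 produces the order-2 quotient datum
`(X, π)`; transporting `ι` and `π` along a diffeomorphism `Φ : M ≅ S⁴` (`g := Φ ∘ ι ∘ Φ⁻¹`, `q := π ∘ Φ⁻¹`, fold charts
`φ ∘ Φ⁻¹` — the only real proof obligation here) gives an order-2 cyclic branched quotient datum of the STANDARD `S⁴`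
with the same orbit space `X`, so `InvolutionQuotient` (STUB 2) yields `X ≅ S⁴`; STUB 3 at `(M, ι, e, X, π)` is the goal.
[folklore] -/
theorem involutionPSC_of_stubs
    (hQ : ∀ (M : Type) [TopologicalSpace M] [T2Space M] [SecondCountableTopology M]
      [ChartedSpace (EuclideanSpace ℝ (Fin 4)) M] [IsManifold (𝓡 4) ∞ M]
      (ι : M → M) (e : Metric.sphere (0 : EuclideanSpace ℝ (Fin 3)) 1 → M),
      ContMDiff (𝓡 4) (𝓡 4) ∞ ι → ι ∘ ι = id →
      Manifold.IsSmoothEmbedding (𝓡 2) (𝓡 4) ∞ e → (∀ x, ι x = x ↔ x ∈ Set.range e) →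
      ∃ (X : Type) (_ : TopologicalSpace X) (_ : T2Space X) (_ : SecondCountableTopology X)
        (_ : ChartedSpace (EuclideanSpace ℝ (Fin 4)) X) (_ : IsManifold (𝓡 4) ∞ X) (π : M → X),
        (ContMDiff (𝓡 4) (𝓡 4) ∞ ι ∧ ι^[2] = id ∧ ContMDiff (𝓡 4) (𝓡 4) ∞ π ∧ (∀ x, π (ι x) = π x) ∧
          (∀ x y, π x = π y → ∃ k : ℕ, y = ι^[k] x) ∧ Function.Surjective π ∧
          (∀ x, ι x ≠ x → IsLocalDiffeomorphAt (𝓡 4) (𝓡 4) ∞ π x) ∧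
          ∀ x, ι x = x → ∃ (U : Set M) (φ : M → EuclideanSpace ℝ (Fin 4)) (V : Set X) (ψ : X → EuclideanSpace ℝ (Fin 4)),
            IsOpen U ∧ x ∈ U ∧ Set.InjOn φ U ∧ (∀ y ∈ U, IsLocalDiffeomorphAt (𝓡 4) (𝓡 4) ∞ φ y) ∧ IsOpen V ∧
            π '' U ⊆ V ∧ Set.InjOn ψ V ∧ (∀ z ∈ V, IsLocalDiffeomorphAt (𝓡 4) (𝓡 4) ∞ ψ z) ∧
            ∀ y ∈ U, ψ (π y) = WithLp.toLp 2 (fun j : Fin 4 =>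
              if j = 2 then ((((φ y 2 : ℝ) : ℂ) + ((φ y 3 : ℝ) : ℂ) * Complex.I) ^ 2).re
              else if j = 3 then ((((φ y 2 : ℝ) : ℂ) + ((φ y 3 : ℝ) : ℂ) * Complex.I) ^ 2).im else φ y j)) ∧
        Manifold.IsSmoothEmbedding (𝓡 2) (𝓡 4) ∞ (π ∘ e))
    (hI : Summit.SmoothPoincare4.SmoothPoincare4.Theses.QuotientSpheres.InvolutionQuotient)
    (hD : ∀ (M : Type) [TopologicalSpace M] [T2Space M] [SecondCountableTopology M]
      [ChartedSpace (EuclideanSpace ℝ (Fin 4)) M] [IsManifold (𝓡 4) ∞ M],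
      Nonempty (M ≃ₘ⟮𝓡 4, 𝓡 4⟯ Metric.sphere (0 : EuclideanSpace ℝ (Fin 5)) 1) →
      ∀ (ι : M → M) (e : Metric.sphere (0 : EuclideanSpace ℝ (Fin 3)) 1 → M),
      ContMDiff (𝓡 4) (𝓡 4) ∞ ι → ι ∘ ι = id →
      Manifold.IsSmoothEmbedding (𝓡 2) (𝓡 4) ∞ e → (∀ x, ι x = x ↔ x ∈ Set.range e) →
      ∀ (X : Type) [TopologicalSpace X] [T2Space X] [SecondCountableTopology X]
        [ChartedSpace (EuclideanSpace ℝ (Fin 4)) X] [IsManifold (𝓡 4) ∞ X] (π : M → X),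
        (ContMDiff (𝓡 4) (𝓡 4) ∞ ι ∧ ι^[2] = id ∧ ContMDiff (𝓡 4) (𝓡 4) ∞ π ∧ (∀ x, π (ι x) = π x) ∧
          (∀ x y, π x = π y → ∃ k : ℕ, y = ι^[k] x) ∧ Function.Surjective π ∧
          (∀ x, ι x ≠ x → IsLocalDiffeomorphAt (𝓡 4) (𝓡 4) ∞ π x) ∧
          ∀ x, ι x = x → ∃ (U : Set M) (φ : M → EuclideanSpace ℝ (Fin 4)) (V : Set X) (ψ : X → EuclideanSpace ℝ (Fin 4)),
            IsOpen U ∧ x ∈ U ∧ Set.InjOn φ U ∧ (∀ y ∈ U, IsLocalDiffeomorphAt (𝓡 4) (𝓡 4) ∞ φ y) ∧ IsOpen V ∧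
            π '' U ⊆ V ∧ Set.InjOn ψ V ∧ (∀ z ∈ V, IsLocalDiffeomorphAt (𝓡 4) (𝓡 4) ∞ ψ z) ∧
            ∀ y ∈ U, ψ (π y) = WithLp.toLp 2 (fun j : Fin 4 =>
              if j = 2 then ((((φ y 2 : ℝ) : ℂ) + ((φ y 3 : ℝ) : ℂ) * Complex.I) ^ 2).re
              else if j = 3 then ((((φ y 2 : ℝ) : ℂ) + ((φ y 3 : ℝ) : ℂ) * Complex.I) ^ 2).im else φ y j)) →
        Manifold.IsSmoothEmbedding (𝓡 2) (𝓡 4) ∞ (π ∘ e) →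
        Nonempty (X ≃ₘ⟮𝓡 4, 𝓡 4⟯ Metric.sphere (0 : EuclideanSpace ℝ (Fin 5)) 1) →
        ∃ (g : Literature.Geometry.Lorentzian.PseudoRiemannianMetric (𝓡 4) ∞ (EuclideanSpace ℝ (Fin 4)) (TangentSpace (𝓡 4) : M → Type _)) (_ : g.HasLeviCivita),
          g.IsRiemannian ∧ (∀ x, 0 < g.scalarCurvature x) ∧
          ∀ y, Literature.Geometry.Lorentzian.pullbackBilin (I := 𝓡 4) (I' := 𝓡 4) ι g.val y = g.val y) :
    ∀ (M : Type) [TopologicalSpace M] [T2Space M] [SecondCountableTopology M] [ChartedSpace (EuclideanSpace ℝ (Fin 4)) M] [IsManifold (𝓡 4) ((⊤ : ℕ∞) : WithTop ℕ∞) M], Nonempty (Diffeomorph (𝓡 4) (𝓡 4) M (Metric.sphere (0 : EuclideanSpace ℝ (Fin 5)) 1) ((⊤ : ℕ∞) : WithTop ℕ∞)) → ∀ (ι : M → M) (e : Metric.sphere (0 : EuclideanSpace ℝ (Fin 3)) 1 → M), ContMDiff (𝓡 4) (𝓡 4) ((⊤ : ℕ∞) : WithTop ℕ∞) ι → ι ∘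 ι = id → Manifold.IsSmoothEmbedding (𝓡 2) (𝓡 4) ((⊤ : ℕ∞) : WithTop ℕ∞) e → (∀ x, ι x = x ↔ x ∈ Set.range e) → ∃ (g : Literature.Geometry.Lorentzian.PseudoRiemannianMetric (𝓡 4) ((⊤ : ℕ∞) : WithTop ℕ∞) (EuclideanSpace ℝ (Fin 4)) (TangentSpace (𝓡 4) : M → Type _)) (_ : g.HasLeviCivita), g.IsRiemannian ∧ (∀ x, 0 < g.scalarCurvature x) ∧ ∀ y, Literature.Geometry.Lorentzian.pullbackBilin (I := 𝓡 4) (I' := 𝓡 4) ι g.val y = g.val y := by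
  intro M _ _ _ _ _ hM ι e hι hinv he hfix
  obtain ⟨X, _, _, _, _, _, π, hdat, hSe⟩ := hQ M ι e hι hinv he hfix
  obtain ⟨Φ⟩ := hM
  have hιι : ∀ x, ι (ι x) = x := fun x => congrFun hinv x
  have hfixe : ∀ p, ι (e p) = e p := fun p => (hfix (e p)).2 ⟨p, rfl⟩
  -- TRANSPORT to the literal sphere: `g := Φ ∘ ι ∘ Φ⁻¹` is an involution of `S⁴` with a fixed point and
  -- `q := π ∘ Φ⁻¹ : S⁴ → X` is an order-2 cyclic branched quotient datum for it (fold charts `φ ∘ Φ⁻¹`), so the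
  -- route-`QuotientSpheres` crux `InvolutionQuotient` recognises the orbit space `X` as the standard `S⁴`.
  have hXstd : Nonempty (X ≃ₘ⟮𝓡 4, 𝓡 4⟯ Metric.sphere (0 : EuclideanSpace ℝ (Fin 5)) 1) := by
    obtain ⟨hι', hι2, hπ, hπι, hfib, hsurj, hloc, hfold⟩ := hdat
    have hne : (Metric.sphere (0 : EuclideanSpace ℝ (Fin 3)) 1).Nonempty := NormedSpace.sphere_nonempty.mpr zero_le_one
    obtain ⟨p₀, hp₀⟩ := hne
    have hsemi : Function.Semiconj (⇑Φ) ι (fun x => Φ (ι (Φ.symm x))) := fun a => by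
      show Φ (ι a) = Φ (ι (Φ.symm (Φ a)))
      rw [Φ.symm_apply_apply]
    refine hI (fun x => Φ (ι (Φ.symm x))) X (fun x => π (Φ.symm x))
      ⟨Φ (e ⟨p₀, hp₀⟩), ?_⟩ ⟨?_, ?_, ?_, ?_, ?_, ?_, ?_, ?_⟩
    · show Φ (ι (Φ.symm (Φ (e ⟨p₀, hp₀⟩)))) = Φ (e ⟨p₀, hp₀⟩)
      rw [Φ.symm_apply_apply, hfixe]
    · exact Φ.contMDiff.comp (hι.comp Φ.symm.contMDiff)
    · have h2 : (fun x => Φ (ι (Φ.symm x)))^[2] = (fun x => Φ (ι (Φ.symm x))) ∘ (fun x => Φ (ι (Φ.symm x))) := by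
        rw [show (2 : ℕ) = 1 + 1 from rfl, Function.iterate_add, Function.iterate_one]
      rw [h2]
      funext x
      show Φ (ι (Φ.symm (Φ (ι (Φ.symm x))))) = x
      rw [Φ.symm_apply_apply, hιι, Φ.apply_symm_apply]
    · exact hπ.comp Φ.symm.contMDiff
    · intro x
      show π (Φ.symm (Φ (ι (Φ.symm x)))) = π (Φ.symm x)
      rw [Φ.symm_apply_apply, hπι]
    · intro x y hxy
      obtain ⟨k, hk⟩ := hfib (Φ.symm x) (Φ.symm y) hxy
      refine ⟨k, ?_⟩
      calc y = Φ (Φ.symm y) := (Φ.apply_symm_apply y).symm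
        _ = Φ (ι^[k] (Φ.symm x)) := by rw [hk]
        _ = (fun x => Φ (ι (Φ.symm x)))^[k] (Φ (Φ.symm x)) := (hsemi.iterate_right k).eq (Φ.symm x)
        _ = (fun x => Φ (ι (Φ.symm x)))^[k] x := by rw [Φ.apply_symm_apply]
    · intro z
      obtain ⟨m, hm⟩ := hsurj z
      exact ⟨Φ m, by show π (Φ.symm (Φ m)) = z; rw [Φ.symm_apply_apply, hm]⟩
    · intro x hx
      have hx' : ι (Φ.symm x) ≠ Φ.symm x := by
        intro h
        apply hx
        show Φ (ι (Φ.symm x)) = x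
        rw [h, Φ.apply_symm_apply]
      exact (Φ.symm.isLocalDiffeomorph x).comp (hg := hloc (Φ.symm x) hx')
    · intro x hx
      have hx' : ι (Φ.symm x) = Φ.symm x := by
        have h := congrArg Φ.symm hx
        rwa [Φ.symm_apply_apply] at h
      obtain ⟨U, φ, V, ψ, hU, hxU, hφinj, hφloc, hV, hπU, hψinj, hψloc, hmodel⟩ := hfold (Φ.symm x) hx'
      refine ⟨Φ.symm ⁻¹' U, φ ∘ Φ.symm, V, ψ, hU.preimage Φ.symm.continuous, hxU, ?_, ?_, hV, ?_, hψinj,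
        hψloc, ?_⟩
      · intro a ha b hb hab
        exact (EquivLike.injective Φ.symm) (hφinj ha hb hab)
      · intro y hy
        exact (Φ.symm.isLocalDiffeomorph y).comp (hg := hφloc (Φ.symm y) hy)
      · rintro _ ⟨y, hy, rfl⟩
        exact hπU ⟨Φ.symm y, hy, rfl⟩
      · intro y hy
        exact hmodel (Φ.symm y) hy
  exact hD M ⟨Φ⟩ ι e hι hinv he hfix X π hdat hSe hXstd

/-- **`InvolutionPSC_of` — THE SKELETON**: the crux `ChargedHalfTurns.InvolutionPSC` BY NAME, closed modulo the three
registered stubs (D-0027 §3.3 shape `<Crux>_proof := crux_of stub₁ stub₂ stub₃`); deliberately the only theorem of the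
file whose conclusion is the crux constant. Becomes the crux proof when the three stubs are discharged (STUB 2 =
item stmt-SmoothPoincare4-8188 of route `QuotientSpheres`). -/
theorem InvolutionPSC_of : Summit.SmoothPoincare4.SmoothPoincare4.Theses.ChargedHalfTurns.InvolutionPSC :=
  involutionPSC_of_stubs stub_halfTurnQuotient stub_quotientStandard stub_deckPSC

/-- BC3 letter: `⟨stub₁-sig⟩ → ⟨stub₂-sig⟩ → ⟨stub₃-sig⟩ → InvolutionPSC` with the crux BY NAME (an `example`, so that
`InvolutionPSC_of` stays the only by-name candidate the skeleton audit sees). -/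
example :
    (∀ (M : Type) [TopologicalSpace M] [T2Space M] [SecondCountableTopology M]
      [ChartedSpace (EuclideanSpace ℝ (Fin 4)) M] [IsManifold (𝓡 4) ∞ M]
      (ι : M → M) (e : Metric.sphere (0 : EuclideanSpace ℝ (Fin 3)) 1 → M),
      ContMDiff (𝓡 4) (𝓡 4) ∞ ι → ι ∘ ι = id →
      Manifold.IsSmoothEmbedding (𝓡 2) (𝓡 4) ∞ e → (∀ x, ι x = x ↔ x ∈ Set.range e) →
      ∃ (X : Type) (_ : TopologicalSpace X) (_ : T2Space X) (_ : SecondCountableTopology X)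
        (_ : ChartedSpace (EuclideanSpace ℝ (Fin 4)) X) (_ : IsManifold (𝓡 4) ∞ X) (π : M → X),
        (ContMDiff (𝓡 4) (𝓡 4) ∞ ι ∧ ι^[2] = id ∧ ContMDiff (𝓡 4) (𝓡 4) ∞ π ∧ (∀ x, π (ι x) = π x) ∧
          (∀ x y, π x = π y → ∃ k : ℕ, y = ι^[k] x) ∧ Function.Surjective π ∧
          (∀ x, ι x ≠ x → IsLocalDiffeomorphAt (𝓡 4) (𝓡 4) ∞ π x) ∧
          ∀ x, ι x = x → ∃ (U : Set M) (φ : M → EuclideanSpace ℝ (Fin 4)) (V : Set X) (ψ : X → EuclideanSpace ℝ (Fin 4)),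
            IsOpen U ∧ x ∈ U ∧ Set.InjOn φ U ∧ (∀ y ∈ U, IsLocalDiffeomorphAt (𝓡 4) (𝓡 4) ∞ φ y) ∧ IsOpen V ∧
            π '' U ⊆ V ∧ Set.InjOn ψ V ∧ (∀ z ∈ V, IsLocalDiffeomorphAt (𝓡 4) (𝓡 4) ∞ ψ z) ∧
            ∀ y ∈ U, ψ (π y) = WithLp.toLp 2 (fun j : Fin 4 =>
              if j = 2 then ((((φ y 2 : ℝ) : ℂ) + ((φ y 3 : ℝ) : ℂ) * Complex.I) ^ 2).re
              else if j = 3 then ((((φ y 2 : ℝ) : ℂ) + ((φ y 3 : ℝ) : ℂ) * Complex.I) ^ 2).im else φ y j)) ∧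
        Manifold.IsSmoothEmbedding (𝓡 2) (𝓡 4) ∞ (π ∘ e)) →
    Summit.SmoothPoincare4.SmoothPoincare4.Theses.QuotientSpheres.InvolutionQuotient →
    (∀ (M : Type) [TopologicalSpace M] [T2Space M] [SecondCountableTopology M]
      [ChartedSpace (EuclideanSpace ℝ (Fin 4)) M] [IsManifold (𝓡 4) ∞ M],
      Nonempty (M ≃ₘ⟮𝓡 4, 𝓡 4⟯ Metric.sphere (0 : EuclideanSpace ℝ (Fin 5)) 1) →
      ∀ (ι : M → M) (e : Metric.sphere (0 : EuclideanSpace ℝ (Fin 3)) 1 → M),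
      ContMDiff (𝓡 4) (𝓡 4) ∞ ι → ι ∘ ι = id →
      Manifold.IsSmoothEmbedding (𝓡 2) (𝓡 4) ∞ e → (∀ x, ι x = x ↔ x ∈ Set.range e) →
      ∀ (X : Type) [TopologicalSpace X] [T2Space X] [SecondCountableTopology X]
        [ChartedSpace (EuclideanSpace ℝ (Fin 4)) X] [IsManifold (𝓡 4) ∞ X] (π : M → X),
        (ContMDiff (𝓡 4) (𝓡 4) ∞ ι ∧ ι^[2] = id ∧ ContMDiff (𝓡 4) (𝓡 4) ∞ π ∧ (∀ x, π (ι x) = π x) ∧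
          (∀ x y, π x = π y → ∃ k : ℕ, y = ι^[k] x) ∧ Function.Surjective π ∧
          (∀ x, ι x ≠ x → IsLocalDiffeomorphAt (𝓡 4) (𝓡 4) ∞ π x) ∧
          ∀ x, ι x = x → ∃ (U : Set M) (φ : M → EuclideanSpace ℝ (Fin 4)) (V : Set X) (ψ : X → EuclideanSpace ℝ (Fin 4)),
            IsOpen U ∧ x ∈ U ∧ Set.InjOn φ U ∧ (∀ y ∈ U, IsLocalDiffeomorphAt (𝓡 4) (𝓡 4) ∞ φ y) ∧ IsOpen V ∧
            π '' U ⊆ V ∧ Set.InjOn ψ V ∧ (∀ z ∈ V, IsLocalDiffeomorphAt (𝓡 4) (𝓡 4) ∞ ψ z) ∧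
            ∀ y ∈ U, ψ (π y) = WithLp.toLp 2 (fun j : Fin 4 =>
              if j = 2 then ((((φ y 2 : ℝ) : ℂ) + ((φ y 3 : ℝ) : ℂ) * Complex.I) ^ 2).re
              else if j = 3 then ((((φ y 2 : ℝ) : ℂ) + ((φ y 3 : ℝ) : ℂ) * Complex.I) ^ 2).im else φ y j)) →
        Manifold.IsSmoothEmbedding (𝓡 2) (𝓡 4) ∞ (π ∘ e) →
        Nonempty (X ≃ₘ⟮𝓡 4, 𝓡 4⟯ Metric.sphere (0 : EuclideanSpace ℝ (Fin 5)) 1) →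
        ∃ (g : Literature.Geometry.Lorentzian.PseudoRiemannianMetric (𝓡 4) ∞ (EuclideanSpace ℝ (Fin 4)) (TangentSpace (𝓡 4) : M → Type _)) (_ : g.HasLeviCivita),
          g.IsRiemannian ∧ (∀ x, 0 < g.scalarCurvature x) ∧
          ∀ y, Literature.Geometry.Lorentzian.pullbackBilin (I := 𝓡 4) (I' := 𝓡 4) ι g.val y = g.val y) →
    Summit.SmoothPoincare4.SmoothPoincare4.Theses.ChargedHalfTurns.InvolutionPSC :=
  involutionPSC_of_stubs

end Summit.SmoothPoincare4.SmoothPoincare4.Cruxes.InvolutionPSC.Birth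

end
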